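import Literature.NumberTheory.EllipticCurves.LocalFrobeniusGenerationProofs
import Literature.NumberTheory.EllipticCurves.UnramifiedLayerRootsProofs
import Mathlib.FieldTheory.Galois.Infinite
import HarnessLib

/-!
# Route (3e) SELMER COMPANION, X: the twisted norm equation over the maximal unramified
# extension of `K_v` (local-field inputs for kind (vi): a NON-SPLIT multiplicative partner at a
# place of good reduction; class X11a = N7; cell `b2b-bsdres`, unit `b2b-bsdres-x11a`, gen 28)

HONEST FRAMING (run/shared/lean/b2b/bsd-rank1-residual/, verbatim in every file): the goal of the
cell is to DELETE the COMBINATION-SHAPED residual classes of the Birch–Swinnerton-Dyer formula for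
ALL analytic-rank `≤ 1` elliptic curves over `ℚ` — "full BSD formula for every rank `≤ 1` curve in
class `C`" assembled STRICTLY from published theorems — so that the rank-`≤ 1` remainder becomes
exactly the CONSTRUCTION-SHAPED classes, which are TYPED (missing-input `Prop`s), NOT attempted.
This is not "finishing BSD". CLASS-OWNERS.md: research routes; NO CLAIM BEYOND STATED CLASSES.
THEOREMS ONLY (no definition, no named fact, no `sorry`); nothing is booked by this file; no label
moves. Pure local algebra: a number field `K`, a finite place `v`, `K_v`, `K̄_v` with the spectral
valuation `w = |·|_v`, `Γ = Γ_{K_v}`, the prime `𝔐` of `\bar 𝓞_v`, its inertia group `I = I_𝔐`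
and an arithmetic Frobenius `F` (`IsArithFrobAt`). No elliptic curve occurs in this file.

## What is proved (inputs of `X11a/SelmerCompanionNonsplitPartner.lean`)

* `apply_ne_of_forall_ne_sq_of_inertia` — **a Frobenius moves `√γ` when `γ ∈ K_v` is not a
  square and inertia fixes `√γ`**: the stabiliser of `t = √γ` is an open subgroup of `Γ`
  (it contains the fixing subgroup of the finite extension `K_v(t)`), so if it contained `F` and
  `I` it would be all of `Γ` (`eq_top_of_isOpen_of_frobenius_mem_of_inertia_le`: in every finite
  quotient of `Γ` the images of `F` and `I` generate), and `t` would lie in `K_v` (`K̄_v/K_v` is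
  Galois). For a non-split multiplicative curve (`γ = −c₄/c₆` not a square, `K_v(√γ)/K_v`
  unramified) this says: the twisting character is `−1` at the Frobenius.
* `exists_mul_frobenius_smul_eq_of_pow_eq_one` — **"twisted Lang" on `μ_p`, `v ∤ p`**: for every
  `p`-th root of unity `ζ` there is a root of unity `u` of order dividing `p(q_v+1)` — hence fixed
  by `I` and raised to the `q_v`-th power by `F` (Serre, *Local Fields*, IV §4 Prop. 16; tree
  `smul_eq_self_of_mem_inertia_of_pow_eq_one`, `frobenius_smul_eq_pow_of_pow_eq_one`) — with
  `u · F(u) = u^{q_v+1} = ζ` (take `u` a `(q_v+1)`-th root of `ζ` in `K̄_v`).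
* `exists_units_mul_frobenius_mul_eq_zpow` — **the twisted norm equation**: let `p` be an odd
  prime with `|p|_v = 1`, `Q ∈ K̄_v^×` fixed by `Γ` (the Tate period), and
  `μ ∈ K̄_v^×` fixed by `I` with `μ^p ∈ Q^ℤ`. Then there is `β ∈ K̄_v^×` fixed by `I` with
  `β · F(β) · μ ∈ Q^ℤ`. Proof: write `μ^p = Q^{pn₀+r}`, `0 ≤ r < p`, `μ₀ = μ Q^{−n₀}`; if `r = 0`,
  `μ₀ ∈ μ_p` and the twisted Lang lemma gives `u F(u) = μ₀^{-1}`; if `0 < r < p`, `q₁ = μ₀^a Q^b`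
  (`ar + bp = 1`) is an `I`-fixed `p`-th root of `Q`, `F(q₁) = ζ₁ q₁` and `μ₀ = ζ₀ q₁^r` with
  `ζ₀, ζ₁ ∈ μ_p`, and for `2c = r(p+1)` (`p` ODD) the element `β₂ = q₁^{−c}` has
  `β₂ F(β₂) μ₀ = ζ₁^{−c} ζ₀ Q^{−r}`; the remaining root of unity is removed by the twisted Lang
  lemma. (For a SPLIT multiplicative curve the relevant equation is the UNtwisted `F(β)/β = μ`,
  which has no solution when `μ = q₁`: `|F(β)/β|_v = 1 > |q₁|_v` — the split level-raising place is
  genuinely lossy, as the census of route (3e) records.)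

## References

* [SerreLocalFields1979] J.-P. Serre, *Local Fields* (1979), Ch. IV §4 Prop. 16 (`μ_m ⊆ K_nr`,
  Frobenius acts by `q`-th powers), Ch. X §1 (Hilbert 90 / Lang for unramified extensions).
* [NeukirchANT1999] J. Neukirch, *Algebraic Number Theory* (1999), Ch. II §9 (9.9)–(9.11)
  (`Γ/I` is topologically generated by the Frobenius).
* [SilvermanATAEC1994] J. H. Silverman, *Advanced Topics*, Ch. V Lemma 5.2 (c), Thm. 5.3,
  Cor. 5.4, Ex. 5.11 (the twisted Tate parametrisation this algebra serves).
* HOME/b2b-bsdres-x11a/REPORT-g28.md.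
-/

set_option autoImplicit false

noncomputable section

open scoped Classical NNReal

open Literature.NumberTheory.EllipticCurves Literature.NumberTheory.GaloisRepresentations Field
  NumberField IsDedekindDomain IsDedekindDomain.HeightOneSpectrum

namespace Summit.BirchSwinnertonDyer.Rank1Residual.X11a.SelmerCompanion

variable {K : Type} [Field K] [NumberField K] {v : HeightOneSpectrum (𝓞 K)}

/-! ### A Frobenius moves `√γ` for a non-square `γ` with unramified square root -/

/-- **A Frobenius moves `√γ` when `γ ∈ K_v` is a non-square whose square roots are fixed by
inertia.** Let `𝔐` be the prime of `\bar 𝓞_v`, `F ∈ Γ_{K_v}` an arithmetic Frobenius at `𝔐`,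
`γ ∈ K_v` not a square in `K_v`, `t ∈ K̄_v` with `t² = γ` and `σ t = t` for all `σ ∈ I_𝔐`. Then
`F t ≠ t`. (The stabiliser of `t` is an open subgroup — it contains the fixing subgroup of the
finite extension `K_v(t)` — so if it contained `F` and `I_𝔐` it would be `Γ_{K_v}`
(`eq_top_of_isOpen_of_frobenius_mem_of_inertia_le`), and `t ∈ K_v` since `K̄_v/K_v` is Galois.)
For a non-split multiplicative curve: the quadratic twisting character of `K_v(√γ)/K_v` takes the
value `−1` at the Frobenius (Silverman, *ATAEC*, V Ex. 5.11).
[cite: NeukirchANT1999, Ch. II §9 Prop. (9.9)–(9.11)] [cite: SilvermanATAEC1994, Ch. V Cor. 5.4, Ex. 5.11] -/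
theorem apply_ne_of_forall_ne_sq_of_inertia {𝔐 : Ideal v.localAbsIntegers}
    (h𝔐 : 𝔐 ∈ v.localPrimesAbove) {F : absoluteGaloisGroup (v.adicCompletion K)}
    (hF : IsArithFrobAt (v.adicCompletionIntegers K) F 𝔐)
    {γ : v.adicCompletion K} (hγ : ∀ r : v.adicCompletion K, γ ≠ r ^ 2)
    {t : AlgebraicClosure (v.adicCompletion K)}
    (ht2 : t ^ 2 = algebraMap (v.adicCompletion K) (AlgebraicClosure (v.adicCompletion K)) γ)
    (ht : ∀ σ ∈ 𝔐.inertia (absoluteGaloisGroup (v.adicCompletion K)),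
      Field.absoluteGaloisGroup.toAlgEquiv (v.adicCompletion K) σ t = t) :
    Field.absoluteGaloisGroup.toAlgEquiv (v.adicCompletion K) F t ≠ t := by
  intro hFt
  -- the stabiliser of `t`: an open subgroup containing `F` and `I_𝔐`, hence everything
  set S : Subgroup (absoluteGaloisGroup (v.adicCompletion K)) :=
    MulAction.stabilizer (absoluteGaloisGroup (v.adicCompletion K)) t with hS
  have hSmem : ∀ σ : absoluteGaloisGroup (v.adicCompletion K),
      σ ∈ S ↔ Field.absoluteGaloisGroup.toAlgEquiv (v.adicCompletion K) σ t = t := fun σ ↦ by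
    rw [hS, MulAction.mem_stabilizer_iff, absoluteGaloisGroup.smul_def]
  have hSopen : IsOpen (S : Set (absoluteGaloisGroup (v.adicCompletion K))) := by
    let L : IntermediateField (v.adicCompletion K) (AlgebraicClosure (v.adicCompletion K)) :=
      IntermediateField.adjoin (v.adicCompletion K) {t}
    haveI : FiniteDimensional (v.adicCompletion K) L :=
      IntermediateField.finiteDimensional_adjoin fun z _ => Algebra.IsIntegral.isIntegral z
    apply Subgroup.isOpen_mono (H₁ := L.fixingSubgroup) ?_ L.fixingSubgroup_isOpen
    intro σ hσ
    rw [IntermediateField.mem_fixingSubgroup_iff] at hσ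
    exact (hSmem σ).mpr (hσ t (IntermediateField.subset_adjoin (v.adicCompletion K) _ (by simp)))
  have hStop : S = ⊤ :=
    v.eq_top_of_isOpen_of_frobenius_mem_of_inertia_le h𝔐 hF hSopen ((hSmem F).mpr hFt)
      (fun σ hσ ↦ (hSmem σ).mpr (ht σ hσ))
  -- so every `σ` fixes `t`, and `t ∈ K_v`
  haveI := isGalois_algebraicClosure_adicCompletion (v := v) (K := K)
  have hmem : t ∈ (⊥ : IntermediateField (v.adicCompletion K)
      (AlgebraicClosure (v.adicCompletion K))) := by
    rw [InfiniteGalois.mem_bot_iff_fixed]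
    intro f
    have hf : (Field.absoluteGaloisGroup.toAlgEquiv (v.adicCompletion K)).symm f ∈ S := by
      rw [hStop]; exact Subgroup.mem_top _
    rw [hSmem, MulEquiv.apply_symm_apply] at hf
    exact hf
  obtain ⟨r, hr⟩ := IntermediateField.mem_bot.mp hmem
  refine hγ r ((algebraMap (v.adicCompletion K) (AlgebraicClosure (v.adicCompletion K))).injective
    ?_)
  rw [map_pow, hr, ht2]

/-! ### Twisted Lang on `μ_p` and the twisted norm equation -/

section Spectral

variable {w : Valuation (AlgebraicClosure (v.adicCompletion K)) ℝ≥0}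
  (hw : ∀ x, (w x : ℝ) =
    spectralNorm (v.adicCompletion K) (AlgebraicClosure (v.adicCompletion K)) x)
include hw

/-- **Twisted Lang on `μ_p` (`v ∤ p`).** For an arithmetic Frobenius `F` at `𝔐`, `p ≠ 0` with
`|p|_v = 1`, and a `p`-th root of unity `ζ ∈ K̄_v`, there is `u ∈ K̄_v^×` FIXED BY THE INERTIA
GROUP with `u · F(u) = ζ`: any `(q_v+1)`-th root `u` of `ζ`, a root of unity of order dividing
`m = p(q_v+1)` with `|m|_v = 1`, so that `I_𝔐` fixes `u` and `F(u) = u^{q_v}`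
(Serre, *Local Fields*, IV §4 Prop. 16; tree `smul_eq_self_of_mem_inertia_of_pow_eq_one`,
`frobenius_smul_eq_pow_of_pow_eq_one`). [cite: SerreLocalFields1979, Ch. IV §4 Prop. 16] -/
theorem exists_mul_frobenius_smul_eq_of_pow_eq_one {𝔐 : Ideal v.localAbsIntegers}
    (h𝔐 : 𝔐 ∈ v.localPrimesAbove) {F : absoluteGaloisGroup (v.adicCompletion K)}
    (hF : IsArithFrobAt (v.adicCompletionIntegers K) F 𝔐) {p : ℕ} (hp0 : p ≠ 0)
    (hwp : w (p : AlgebraicClosure (v.adicCompletion K)) = 1)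
    {ζ : AlgebraicClosure (v.adicCompletion K)} (hζ : ζ ^ p = 1) :
    ∃ u : AlgebraicClosure (v.adicCompletion K), u ≠ 0 ∧
      (∀ τ ∈ 𝔐.inertia (absoluteGaloisGroup (v.adicCompletion K)), τ • u = u) ∧
      u * (F • u) = ζ := by
  set qv := Nat.card (IsLocalRing.ResidueField (v.adicCompletionIntegers K)) with hqv
  obtain ⟨u, hu⟩ := IsAlgClosed.exists_pow_nat_eq ζ (Nat.succ_pos qv)
  have hζ0 : ζ ≠ 0 := by
    rintro rfl
    rw [zero_pow hp0] at hζ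
    exact zero_ne_one hζ
  have hu0 : u ≠ 0 := by
    rintro rfl
    rw [zero_pow (Nat.succ_ne_zero qv)] at hu
    exact hζ0 hu.symm
  set m : ℕ := p * (qv + 1) with hm
  have hm0 : m ≠ 0 := mul_ne_zero hp0 (Nat.succ_ne_zero qv)
  have hwm : w (m : AlgebraicClosure (v.adicCompletion K)) = 1 := by
    rw [hm, Nat.cast_mul, map_mul, hwp, one_mul, Nat.cast_succ, add_comm]
    exact Valuation.map_one_add_of_lt w (spectralValuation_natCast_residueCard_lt_one hw)
  have hum : u ^ m = 1 := by rw [hm, mul_comm, pow_mul, hu, hζ]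
  refine ⟨u, hu0, fun τ hτ ↦ smul_eq_self_of_mem_inertia_of_pow_eq_one hw h𝔐 hτ hm0 hwm hum, ?_⟩
  rw [frobenius_smul_eq_pow_of_pow_eq_one hw h𝔐 hF hm0 hwm hum, ← pow_succ', hu]

/-- **The twisted norm equation over `K_v^nr`.** Let `p` be an ODD prime with `|p|_v = 1`, `F` an
arithmetic Frobenius at `𝔐`, `Q ∈ K̄_v^×` fixed by `Γ_{K_v}` (in the application the Tate period,
`|Q|_v < 1`, but this is not used), and `μ ∈ K̄_v^×` fixed by `I_𝔐` with `μ^p ∈ Q^ℤ`. Then there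
is `β ∈ K̄_v^×` fixed by `I_𝔐` with
`β · F(β) · μ ∈ Q^ℤ`. Proof in the module docstring (`μ^p = Q^{pn₀+r}`; `r = 0`: twisted Lang on
`μ_p`; `0 < r < p`: an `I`-fixed `p`-th root `q₁` of `Q`, `β₂ = q₁^{-c}` with `2c = r(p+1)`, and
twisted Lang for the residual root of unity). This is the multiplicative-group computation behind
"every `K_v`-point of a NON-SPLIT Tate curve with `p ∣ ord_v(q)` is in the image of `F − 1` on the
`I`-invariants", i.e. `H¹(K_v^nr/K_v, E(K_v^nr))[p] = 0` for non-split multiplicative `E`, `p` odd,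
`v ∤ p` (Milne, *ADT*, I Prop. 3.8 / Silverman, *ATAEC*, V Cor. 5.4, Ex. 5.11).
[cite: SilvermanATAEC1994, Ch. V Cor. 5.4, Ex. 5.11] [cite: SerreLocalFields1979, Ch. IV §4 Prop. 16] -/
theorem exists_units_mul_frobenius_mul_eq_zpow {𝔐 : Ideal v.localAbsIntegers}
    (h𝔐 : 𝔐 ∈ v.localPrimesAbove) {F : absoluteGaloisGroup (v.adicCompletion K)}
    (hF : IsArithFrobAt (v.adicCompletionIntegers K) F 𝔐) {p : ℕ} (hp : p.Prime) (hp2 : p ≠ 2)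
    (hwp : w (p : AlgebraicClosure (v.adicCompletion K)) = 1)
    {Q : (AlgebraicClosure (v.adicCompletion K))ˣ}
    (hQ : ∀ σ : absoluteGaloisGroup (v.adicCompletion K),
      σ • (Q : AlgebraicClosure (v.adicCompletion K)) = Q)
    {μ : (AlgebraicClosure (v.adicCompletion K))ˣ} (hμp : ∃ n : ℤ, μ ^ p = Q ^ n)
    (hμI : ∀ τ ∈ 𝔐.inertia (absoluteGaloisGroup (v.adicCompletion K)),
      τ • (μ : AlgebraicClosure (v.adicCompletion K)) = μ) :
    ∃ β : (AlgebraicClosure (v.adicCompletion K))ˣ,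
      (∀ τ ∈ 𝔐.inertia (absoluteGaloisGroup (v.adicCompletion K)),
        τ • (β : AlgebraicClosure (v.adicCompletion K)) = β) ∧
      ∃ s : ℤ, β * Units.map (Field.absoluteGaloisGroup.toAlgEquiv (v.adicCompletion K) F :
          AlgebraicClosure (v.adicCompletion K) →* AlgebraicClosure (v.adicCompletion K)) β * μ =
        Q ^ s := by
  -- the action on units
  set gal : absoluteGaloisGroup (v.adicCompletion K) →
      (AlgebraicClosure (v.adicCompletion K))ˣ →* (AlgebraicClosure (v.adicCompletion K))ˣ :=
    fun σ ↦ Units.map (Field.absoluteGaloisGroup.toAlgEquiv (v.adicCompletion K) σ :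
      AlgebraicClosure (v.adicCompletion K) →* AlgebraicClosure (v.adicCompletion K)) with hgal
  have hgal_coe : ∀ (σ : absoluteGaloisGroup (v.adicCompletion K))
      (u : (AlgebraicClosure (v.adicCompletion K))ˣ),
      ((gal σ u : (AlgebraicClosure (v.adicCompletion K))ˣ) :
        AlgebraicClosure (v.adicCompletion K)) = σ • (u : AlgebraicClosure (v.adicCompletion K)) :=
    fun σ u ↦ rfl
  have hfix : ∀ (σ : absoluteGaloisGroup (v.adicCompletion K))
      (u : (AlgebraicClosure (v.adicCompletion K))ˣ),
      σ • (u : AlgebraicClosure (v.adicCompletion K)) = u → gal σ u = u :=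
    fun σ u h ↦ Units.ext (by rw [hgal_coe]; exact h)
  have hQσ : ∀ σ : absoluteGaloisGroup (v.adicCompletion K), gal σ Q = Q := fun σ ↦ hfix σ Q (hQ σ)
  change ∃ β : (AlgebraicClosure (v.adicCompletion K))ˣ,
      (∀ τ ∈ 𝔐.inertia (absoluteGaloisGroup (v.adicCompletion K)),
        τ • (β : AlgebraicClosure (v.adicCompletion K)) = β) ∧ ∃ s : ℤ, β * gal F β * μ = Q ^ s
  have hp0 : (p : ℤ) ≠ 0 := by exact_mod_cast hp.ne_zero
  obtain ⟨n, hn⟩ := hμp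
  -- `n = p n₀ + r`, `0 ≤ r < p`; `μ₀ = μ Q^{-n₀}` has `μ₀^p = Q^r`
  set n₀ : ℤ := n / p with hn₀
  set r : ℤ := n % p with hr
  have hnr : n = p * n₀ + r := by rw [hn₀, hr, Int.mul_ediv_add_emod]
  have hr0 : 0 ≤ r := Int.emod_nonneg _ hp0
  have hrp : r < p := Int.emod_lt_of_pos _ (by exact_mod_cast hp.pos)
  set μ₀ : (AlgebraicClosure (v.adicCompletion K))ˣ := μ * Q ^ (-n₀) with hμ₀
  have hμ : μ = μ₀ * Q ^ n₀ := by
    rw [hμ₀, mul_assoc, ← zpow_add, neg_add_cancel, zpow_zero, mul_one]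
  have hμ₀p : μ₀ ^ p = Q ^ r := by
    rw [hμ₀, mul_pow, hn, ← zpow_natCast (Q ^ (-n₀)) p, ← zpow_mul, ← zpow_add, hnr]
    congr 1
    ring
  have hμ₀I : ∀ τ ∈ 𝔐.inertia (absoluteGaloisGroup (v.adicCompletion K)), gal τ μ₀ = μ₀ := by
    intro τ hτ
    rw [hμ₀, map_mul, map_zpow, hfix τ μ (hμI τ hτ), hQσ]
  -- KEY: `β₂` fixed by `I`, `ζ₂ ∈ μ_p`, `e`, with `β₂ F(β₂) μ₀ = ζ₂ Q^e`
  have key : ∃ (β₂ ζ₂ : (AlgebraicClosure (v.adicCompletion K))ˣ) (e : ℤ),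
      (∀ τ ∈ 𝔐.inertia (absoluteGaloisGroup (v.adicCompletion K)), gal τ β₂ = β₂) ∧
        ζ₂ ^ p = 1 ∧ β₂ * gal F β₂ * μ₀ = ζ₂ * Q ^ e := by
    by_cases hr00 : r = 0
    · refine ⟨1, μ₀, 0, fun τ _ ↦ map_one _, ?_, ?_⟩
      · rw [hμ₀p, hr00, zpow_zero]
      · rw [map_one, one_mul, one_mul, zpow_zero, mul_one]
    · -- `0 < r < p`: `r` is prime to `p`
      obtain ⟨rn, hrn⟩ : ∃ rn : ℕ, (rn : ℤ) = r := ⟨r.toNat, Int.toNat_of_nonneg hr0⟩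
      have hrn0 : rn ≠ 0 := by
        rintro rfl
        exact hr00 (by rw [← hrn, Nat.cast_zero])
      have hrnp : rn < p := by exact_mod_cast (hrn ▸ hrp : (rn : ℤ) < p)
      have hndvd : ¬ p ∣ rn := fun h ↦ hrn0 (Nat.eq_zero_of_dvd_of_lt h hrnp)
      have hcop : IsCoprime (rn : ℤ) (p : ℤ) :=
        Nat.isCoprime_iff_coprime.mpr ((Nat.Prime.coprime_iff_not_dvd hp).mpr hndvd).symm
      obtain ⟨a, b, hab⟩ := hcop
      rw [hrn] at hab
      -- `q₁ = μ₀^a Q^b`, an `I`-fixed `p`-th root of `Q`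
      set q₁ : (AlgebraicClosure (v.adicCompletion K))ˣ := μ₀ ^ a * Q ^ b with hq₁
      have hq₁p : q₁ ^ (p : ℤ) = Q := by
        rw [hq₁, mul_zpow, ← zpow_mul, ← zpow_mul, mul_comm a, zpow_mul, zpow_natCast, hμ₀p,
          ← zpow_mul, ← zpow_add]
        conv_rhs => rw [← zpow_one Q]
        congr 1
        linear_combination hab
      have hq₁pn : q₁ ^ p = Q := by rw [← zpow_natCast, hq₁p]
      have hq₁I : ∀ τ ∈ 𝔐.inertia (absoluteGaloisGroup (v.adicCompletion K)), gal τ q₁ = q₁ := by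
        intro τ hτ
        rw [hq₁, map_mul, map_zpow, map_zpow, hμ₀I τ hτ, hQσ]
      -- `F(q₁) = ζ₁ q₁`, `μ₀ = ζ₀ q₁^r` with `ζ₀, ζ₁ ∈ μ_p`
      set ζ₁ : (AlgebraicClosure (v.adicCompletion K))ˣ := gal F q₁ * q₁⁻¹ with hζ₁
      have hFq₁ : gal F q₁ = ζ₁ * q₁ := by rw [hζ₁, inv_mul_cancel_right]
      have hζ₁p : ζ₁ ^ p = 1 := by
        rw [hζ₁, mul_pow, ← map_pow, inv_pow, hq₁pn, hQσ F, mul_inv_cancel]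
      set ζ₀ : (AlgebraicClosure (v.adicCompletion K))ˣ := μ₀ * q₁ ^ (-r) with hζ₀
      have hζ₀p : ζ₀ ^ p = 1 := by
        rw [hζ₀, mul_pow, hμ₀p, ← zpow_natCast (q₁ ^ (-r)) p, ← zpow_mul, neg_mul, zpow_neg,
          mul_comm r, zpow_mul, hq₁p, mul_inv_cancel]
      -- `2c = r(p+1)` (`p` odd) and `β₂ = q₁^{-c}`
      obtain ⟨k, hk⟩ := hp.odd_of_ne_two hp2
      set c : ℤ := r * (k + 1) with hc
      have h2c : -c + -c = -r + (p : ℤ) * -r := by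
        rw [hc, hk]
        push_cast
        ring
      refine ⟨q₁ ^ (-c), ζ₁ ^ (-c) * ζ₀, -r, fun τ hτ ↦ by rw [map_zpow, hq₁I τ hτ], ?_, ?_⟩
      · rw [mul_pow, ← zpow_natCast (ζ₁ ^ (-c)) p, ← zpow_mul, mul_comm (-c), zpow_mul,
          zpow_natCast, hζ₁p, one_zpow, one_mul, hζ₀p]
      · have h1 : q₁ ^ (-c) * q₁ ^ (-c) = q₁ ^ (-r) * Q ^ (-r) := by
          rw [← zpow_add, ← hq₁p, ← zpow_mul, ← zpow_add, h2c]
        rw [map_zpow, hFq₁, mul_zpow ζ₁ q₁ (-c), hζ₀]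
        calc q₁ ^ (-c) * (ζ₁ ^ (-c) * q₁ ^ (-c)) * μ₀
            = ζ₁ ^ (-c) * μ₀ * (q₁ ^ (-c) * q₁ ^ (-c)) := by
              simp only [mul_assoc, mul_comm, mul_left_comm]
          _ = ζ₁ ^ (-c) * μ₀ * (q₁ ^ (-r) * Q ^ (-r)) := by rw [h1]
          _ = ζ₁ ^ (-c) * (μ₀ * q₁ ^ (-r)) * Q ^ (-r) := by
              simp only [mul_assoc, mul_comm, mul_left_comm]
  obtain ⟨β₂, ζ₂, e, hβ₂I, hζ₂p, hkey⟩ := key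
  -- twisted Lang for `ζ₂⁻¹`
  have hζ₂' : ((ζ₂⁻¹ : (AlgebraicClosure (v.adicCompletion K))ˣ) :
      AlgebraicClosure (v.adicCompletion K)) ^ p = 1 := by
    rw [← Units.val_pow_eq_pow_val, inv_pow, hζ₂p, inv_one, Units.val_one]
  obtain ⟨u, hu0, huI, huF⟩ :=
    exists_mul_frobenius_smul_eq_of_pow_eq_one hw h𝔐 hF hp.ne_zero hwp hζ₂'
  set u₀ : (AlgebraicClosure (v.adicCompletion K))ˣ := Units.mk0 u hu0 with hu₀
  have hu₀F : u₀ * gal F u₀ = ζ₂⁻¹ := Units.ext (by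
    rw [Units.val_mul, hgal_coe, hu₀, Units.val_mk0]
    exact huF)
  refine ⟨u₀ * β₂, fun τ hτ ↦ ?_, e + n₀, ?_⟩
  · rw [Units.val_mul, smul_mul', hu₀, Units.val_mk0, huI τ hτ, ← hgal_coe, hβ₂I τ hτ]
  · rw [map_mul, hμ, zpow_add]
    calc u₀ * β₂ * (gal F u₀ * gal F β₂) * (μ₀ * Q ^ n₀)
        = (u₀ * gal F u₀) * (β₂ * gal F β₂ * μ₀) * Q ^ n₀ := by
          simp only [mul_assoc, mul_comm, mul_left_comm]
      _ = ζ₂⁻¹ * (ζ₂ * Q ^ e) * Q ^ n₀ := by rw [hu₀F, hkey]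
      _ = Q ^ e * Q ^ n₀ := by rw [inv_mul_cancel_left]

end Spectral

end Summit.BirchSwinnertonDyer.Rank1Residual.X11a.SelmerCompanion

end
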